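/-
Origin: expansion seat `planner-pub-hodgecm-mc-axioms-1-g14-0`, handover #W128 2026-08-20T15:53:55Z md5 fce52eedd78f (PKG b79427432300 → fce52eedd78f; 222 l.; MECHANICAL (iib-R) rewrite v3.1 of the PKG file as it stands (13 token edits; rules R1x1+RX[h₂]x12)) (`HOME/mc/pub-hodgecm-mc-axioms-1-g14/revendor/kit-r55/stage55/HodgeCM/Model/ArchKType.lean`, md5 fce52eedd78f, 222 lines);
landed by the gen-22 packager (p-g22) in gate run 55 REPLACES the earlier landed copy of `HodgeCM/Model/ArchKType.lean` (seat copy carried the packager Origin header of an earlier run (stripped)).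
-/
/-
(Θ-sat)/(W1) #R1′ DRAFT by `planner-pub-hodgecm-mc-theta-3-g8-0` 2026-08-19 over the (C-Kf∞) re-cut #R1 395253e2d0e8
(`mc-theta-3-g5/lean/recut-ckf/…`, kit `t36-mctheta3g5-recut.txt` b5dc23ddeec9): + Prop field `ArchKTypeData.sat`, `toProduct` fills
`ProductKTypeData.sat`; everything else byte-identical.  UNCHECKED (rides RUN 37 with the `Level`-pair root packet).
Origin: expansion seat `planner-pub-hodgecm-mc-theta-3-g3-0`, handover #5 2026-08-19T00:49Z md5 0907b1d7eacf551bcb9f94dbc623e3bc (NEW additive leaf, 200 l.; ns HodgeCM.Model (+ .ArchKTypeData); imports HodgeCM.Model.SupplySituation (#4) only; testFunL K J x0 N : Schwartz(J -> K_inf) ->L[C] piSchwartzBruhat K J (testFun LINEAR in the archimedean factor, kernel), structure ArchKTypeData X k N (Gamma0, K2/kappa2/comm/level, Phiarch, l0, arch0, omegainf : Representation  (`HOME/mc/pub-hodgecm-mc-theta-3-g3/lean/stage/HodgeCM/Model/ArchKType.lean`, md5 0907b1d7, 200 lines);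
landed by the gen-9 packager (p-g9) in gate run 33 as `HodgeCM/Model/ArchKType.lean` (verbatim).
-/
/-
Copyright (c) 2026. Released under Apache 2.0 license as described in the file LICENSE.
Cell pub-hodgecm, MODEL layer (construction prover mc-theta-3, gen 3), nodes W6b-Kf / W6b-K∞ / T3-classPacks
of `MODEL-DAG.md`: the archimedean harmonic family of test functions and the product `K`-type data it yields.
-/
import Summits.HodgeConjecture.HodgeCM.Model.SupplySituation

/-!
# The archimedean family `ℓ ↦ Φ_∞(ℓ) ⊗ 1_{x₀ + N𝒪̂}` and its product `K`-type data

`Model/SupplySituation` builds the supply situation at `φ_N` from `ProductKTypeData X k N`, whose analytic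
content is a LINEAR family `Φfam : W^∨ → 𝒮(𝔸_K^J)` through `φ_N` with (W-Kf) `fix` and (W-K∞) `arch`.  This
file separates the owners of that content:

* `testFunₗ K J x₀ N : 𝒮((J → K_∞), ℂ) →ₗ[ℂ] 𝒮(𝔸_K^J)`, `Φ_∞ ↦ φ_N(Φ_∞) = Φ_∞ ⊗ 1_{x₀ + N𝒪̂^J}` — `testFun` is
  LINEAR in its archimedean factor (kernel: `testFunₗ_apply`);
* `ArchKTypeData X k N` — the level `Γ₀` and finite `K`-type `K₂, κ₂, comm, level` as before, and, in place of
  `Φfam / fam₀ / fix / arch`: an archimedean family `Φarch : W^∨ →ₗ 𝒮((J → K_∞), ℂ)` through `Φ_∞`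
  (`arch₀ : Φarch ℓ₀ = (X.P k).Φinf`), an archimedean action `ωinf : Representation ℂ X.G₁ 𝒮((J → K_∞), ℂ)`
  (the archimedean Weil representation restricted to `U(V)(ℝ)`), and three NAMED statements with distinct owners:
  (W-Kf′) `fixN : ∀ m ℓ, ω (κ₂ m, 1) (φ_N(Φ_∞(ℓ))) = φ_N(Φ_∞(ℓ))` — the finite `K`-type fixes the FAMILY
  `Φ_∞(ℓ) ⊗ 1_{x₀+N𝒪̂}` (exactly what `toProduct.fix` consumes; RE-TYPED 2026-08-19 from the former «every
  `Φ_∞ ⊗ 1_{x₀+N𝒪̂}`» after finding (C-Kf∞), unitary-2-g6 07:32:48Z / model1-g5 RULING 07:33:56Z: at the honest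
  restricted-tensor `ω` with `g = [L⁺:ℚ] ≥ 2` the ∀`Φ_∞` form forces `κ₂(K₂)` archimedean-trivial (local Weil
  representations are faithful) while `level` needs the corrector `κ₂ m` to carry the compact components
  `σ_w(γ)`, `w ≠ w₁` — jointly unsatisfiable; the family form is fixed by `K₂ ⊇ SU(3)_w` at the definite places
  because the harmonic vectors there are Gaussians);
  (W-⊗′) `prodN : ∀ g Φ_∞, ω (ιinf g, 1) (φ_N(Φ_∞)) = φ_N(ωinf g Φ_∞)` — the
  archimedean component acts through `ωinf` on the archimedean factor (product structure of `ω`);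
  (W-K∞′) `harm : ∀ u ℓ, ωinf (κ₁ u) (Φarch ℓ) = Φarch (τ₁^∨(u) ℓ)` — the harmonic family is `K_∞`-equivariant of
  type `τ₁^∨` under the ARCHIMEDEAN Weil representation alone;
* `ArchKTypeData.toProduct : ProductKTypeData X k N` — `Φfam := testFunₗ ∘ Φarch`, `fam₀` PROVED from `arch₀`,
  `fix` from `fixN`, `arch` from `prodN` + `harm` (kernel);
* `ArchKTypeData.toSupplySituationAt`, `classPacksOf_archKType` — E's `classPacks` at the END STATE model from
  one `ArchKTypeData` + holomorphy (W6b-hol) per good sextic context, `k ∈ {0,1}`, `N > 0`.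

Nothing is cited and nothing is minted: definitions and kernel lemmas over `Model/SupplySituation`.
-/

set_option autoImplicit false

noncomputable section

open MeasureTheory
open Literature.NumberTheory.Automorphic Literature.NumberTheory.Weil1964
open Literature.NumberTheory.Automorphic.WeightForms (ClassMapDatum thetaClasses restrictHom IsLevelCorrected
  IsWeightMatched)
open Literature.AlgebraicGeometry.HodgeTheory
open Literature.NumberTheory.Automorphic.PicardCM
open HodgeCM.PerL34.Seesaw HodgeCM.PerL34.RationalCoset HodgeCM.PerL34.SupplyAdelic
open HodgeCM.Model.SupplyInstance HodgeCM.Model.SupplyResidual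
open HodgeCM.Model.SupplyResidual.WeilPairData (charInv)
open HodgeCM.Model.ThetaSpace
open scoped Classical SchwartzMap

namespace HodgeCM
namespace Model

/-! ### § 1. `testFun` is linear in its archimedean factor -/

section TestFunLinear

open NumberField NumberField.mixedEmbedding IsDedekindDomain

variable (K : Type) [Field K] [NumberField K] (J : Type) [Fintype J]

/-- **`Φ_∞ ↦ φ_N(Φ_∞) = Φ_∞ ⊗ 1_{x₀ + N𝒪̂^J}`** as a `ℂ`-linear map `𝒮((J → K_∞), ℂ) → 𝒮(𝔸_K^J)`. -/
def testFunₗ (x₀ : J → K) (N : ℕ) : 𝓢((J → mixedSpace K), ℂ) →ₗ[ℂ] piSchwartzBruhat K J where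
  toFun Φinf := testFun K J Φinf x₀ N
  map_add' Φ Ψ := by
    apply Subtype.ext
    funext v
    simp only [coe_testFun, Submodule.coe_add, Pi.add_apply, thinCosetTestFun, add_apply, add_mul]
  map_smul' a Φ := by
    apply Subtype.ext
    funext v
    simp only [coe_testFun, Submodule.coe_smul, Pi.smul_apply, thinCosetTestFun, smul_apply,
      smul_eq_mul, RingHom.id_apply, mul_assoc]

/-- (Ported verbatim from the HodgeCMPerL package; no docstring in the source.) -/
@[simp] theorem testFunₗ_apply (x₀ : J → K) (N : ℕ) (Φinf : 𝓢((J → mixedSpace K), ℂ)) :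
    testFunₗ K J x₀ N Φinf = testFun K J Φinf x₀ N := rfl

end TestFunLinear

variable {U : Universe} {Lc : CMField} {ι₁ : Lc →+* ℂ} {V : HermSpace3 Lc ι₁} {c : SeesawCtx Lc}

/-! ### § 2. Archimedean `K`-type data -/

open NumberField.mixedEmbedding in
/-- **Archimedean `K`-type data at `φ_N`**: level and finite `K`-type as in `ProductKTypeData`, an archimedean
family through `Φ_∞` and an archimedean action `ωinf` of `G₁`, with (W-Kf′) `fixN`, (W-⊗′) `prodN`,
(W-K∞′) `harm`. -/
structure ArchKTypeData (X : ThetaSpaceInput U V c) (k : Fin 4) (N : ℕ) : Type 1 where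
  /-- the level at which the classes are supplied -/
  Γ₀ : Level V
  /-- the finite part `K_f(N)` of the `K`-type -/
  K₂ : Type
  [instK₂ : Group K₂]
  /-- its map to `G_U(𝔸)` -/
  κ₂ : K₂ →* X.GU
  /-- it commutes with the archimedean component -/
  comm : ∀ (m : K₂) (x : X.G₁), Commute (κ₂ m) (X.ιinf Γ₀ x)
  /-- it absorbs the level: `γ_f ∈ K_f(N)` for `γ ∈ Γ₀` -/
  level : ∀ δ ∈ X.Δ Γ₀, ∃ m : K₂, X.ιinf Γ₀ δ * κ₂ m ∈ (X.P k).ΓU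
  /-- saturation ((Θ-sat)): every element of the compact open `K_{Γ₀}` of the level, placed in `G_U(𝔸)`, is an
  index element (at `Γ₀ = (Γ(M), K(M))` with `K₂ := K(M)`: the identity) -/
  sat : ∀ g ∈ X.KΓ Γ₀, ∃ m : K₂, κ₂ m = g
  /-- the archimedean (harmonic) family `ℓ ↦ Φ_∞(ℓ)` -/
  Φarch : Module.Dual ℂ X.W →ₗ[ℂ] 𝓢((X.J → mixedSpace X.K), ℂ)
  /-- the covector at which the family passes through `Φ_∞` -/
  ℓ₀ : Module.Dual ℂ X.W
  /-- `Φarch ℓ₀ = Φ_∞` -/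
  arch₀ : Φarch ℓ₀ = (X.P k).Φinf
  /-- the archimedean Weil action of `G₁ = U(V)(ℝ)` on `𝒮((J → K_∞), ℂ)` -/
  ωinf : Representation ℂ X.G₁ 𝓢((X.J → mixedSpace X.K), ℂ)
  /-- (W-Kf′) the finite `K`-type fixes the family `Φ_∞(ℓ) ⊗ 1_{x₀ + N𝒪̂}` (family form, re-typed after
  finding (C-Kf∞) 2026-08-19: NOT «every `Φ_∞`», which is unsatisfiable jointly with `level` at the honest pin) -/
  fixN : ∀ (m : K₂) (ℓ : Module.Dual ℂ X.W),
    (X.P k).ω (κ₂ m, 1) (testFun X.K X.J (Φarch ℓ) (X.P k).x₀ N) = testFun X.K X.J (Φarch ℓ) (X.P k).x₀ N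
  /-- (W-⊗′) the archimedean component acts through `ωinf` on the archimedean factor -/
  prodN : ∀ (g : X.G₁) (Φinf : 𝓢((X.J → mixedSpace X.K), ℂ)),
    (X.P k).ω (X.ιinf Γ₀ g, 1) (testFun X.K X.J Φinf (X.P k).x₀ N) = testFun X.K X.J (ωinf g Φinf) (X.P k).x₀ N
  /-- (W-K∞′) the family is `K₁`-equivariant of type `τ₁^∨` under `ωinf` -/
  harm : ∀ (u : X.K₁) (ℓ : Module.Dual ℂ X.W), ωinf (X.κ₁ u) (Φarch ℓ) = Φarch (X.τ₁.dual u ℓ)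

attribute [instance] ArchKTypeData.instK₂

namespace ArchKTypeData

variable {X : ThetaSpaceInput U V c} {k : Fin 4} {N : ℕ} (C : ArchKTypeData X k N)

/-- The adelic family `ℓ ↦ Φ_∞(ℓ) ⊗ 1_{x₀ + N𝒪̂}`. -/
def Φfam : Module.Dual ℂ X.W →ₗ[ℂ] piSchwartzBruhat X.K X.J := testFunₗ X.K X.J (X.P k).x₀ N ∘ₗ C.Φarch

/-- (Ported verbatim from the HodgeCMPerL package; no docstring in the source.) -/
@[simp] theorem Φfam_apply (ℓ : Module.Dual ℂ X.W) :
    C.Φfam ℓ = testFun X.K X.J (C.Φarch ℓ) (X.P k).x₀ N := rfl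

/-- **The product `K`-type data** of the archimedean data: `fam₀`, `fix`, `arch` PROVED. -/
def toProduct : ProductKTypeData X k N where
  Γ₀ := C.Γ₀
  K₂ := C.K₂
  κ₂ := C.κ₂
  comm := C.comm
  level := C.level
  sat := C.sat
  Φfam := C.Φfam
  ℓ₀ := C.ℓ₀
  fam₀ := by rw [Φfam_apply, C.arch₀]
  fix m ℓ := by rw [Φfam_apply]; exact C.fixN m ℓ
  arch u ℓ := by rw [Φfam_apply, Φfam_apply, C.prodN, C.harm]

/-- (Ported verbatim from the HodgeCMPerL package; no docstring in the source.) -/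
@[simp] theorem toProduct_Γ₀ : C.toProduct.Γ₀ = C.Γ₀ := rfl

/-- The supply situation at `φ_N` from archimedean `K`-type data and holomorphy (W6b-hol). -/
def toSupplySituationAt
    (hol : ∀ f ∈ (X.P k).weightFunctions, C.toProduct.restrictedThetaForm f ∈ (X.D C.Γ₀).Hol) :
    SupplySituationAt X k N :=
  C.toProduct.toSupplySituationAt hol

end ArchKTypeData

/-! ### § 3. E's `classPacks` from archimedean `K`-type data -/

section EndState

variable (hHD : exists_isReal_hodgeModel) (hI : hodgePQ_independent_of_hodgeModel)
  (h₁ : BallQuotientUniformised)  (h₃ : CMAbelianVarietyRealised)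

/-- **E's `classPacks` at the END STATE's model from archimedean `K`-type data**: one `ArchKTypeData (X V c) k N`
and the holomorphy (W6b-hol) of the restricted theta forms of its family, per good sextic context,
`k ∈ {0,1}`, `N > 0`. -/
theorem classPacksOf_archKType (h : Bool)
    (emb : ∀ {L : CMField} {ι₁ : L →+* ℂ} {V : HermSpace3 L ι₁} (Γ : Level V),
      (picardCMUniverse hHD hI h₁ h₃).CohC ((picardCMUniverse hHD hI h₁ h₃).pms L ι₁ V Γ) 2 →ₗ[ℂ]
        (V.latticeModel printFact_unitaryCompact_holds).toQuotientModel.H)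
    (cover : ∀ {L : CMField} {ι₁ : L →+* ℂ} {V : HermSpace3 L ι₁} (Γ Γ' : Level V),
      Γ'.Γ ≤ Γ.Γ → (picardCMUniverse hHD hI h₁ h₃).Mor ((picardCMUniverse hHD hI h₁ h₃).pms L ι₁ V Γ')
        ((picardCMUniverse hHD hI h₁ h₃).pms L ι₁ V Γ))
    (wm : ∀ {L : CMField} {ι₁ : L →+* ℂ} (V : HermSpace3 L ι₁) (c : SeesawCtx L),
      WeilThetaModel (V.latticeModel printFact_unitaryCompact_holds).toQuotientModel.G
        (V.latticeModel printFact_unitaryCompact_holds).toQuotientModel.Γ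
        (c.D.latticeModelW printFact_unitaryCompact_holds).toQuotientModel.G
        (c.D.latticeModelW printFact_unitaryCompact_holds).toQuotientModel.Γ)
    (X : ∀ {L : CMField} {ι₁ : L →+* ℂ} (V : HermSpace3 L ι₁) (c : SeesawCtx L),
      ThetaSpaceInput (picardCMUniverse hHD hI h₁ h₃) V c)
    (d12 d34 : ∀ {L : CMField}, SeesawCtx L → HodgeCM.Universe.SideData L)
    (C : ∀ {L : CMField} {ι₁ : L →+* ℂ} (V : HermSpace3 L ι₁) (c : SeesawCtx L),
      (thetaModelOf hHD hI h₁ h₃ h emb cover wm (thetaOf _ (thetaClassInputOf _ X)) d12 d34).GoodCtx ι₁ c →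
      Module.finrank ℚ c.K = 6 → ∀ k : Fin 4, k = 0 ∨ k = 1 → ∀ N : ℕ, 0 < N → ArchKTypeData (X V c) k N)
    (hol : ∀ {L : CMField} {ι₁ : L →+* ℂ} (V : HermSpace3 L ι₁) (c : SeesawCtx L)
      (hc : (thetaModelOf hHD hI h₁ h₃ h emb cover wm (thetaOf _ (thetaClassInputOf _ X)) d12 d34).GoodCtx
        ι₁ c)
      (h6 : Module.finrank ℚ c.K = 6) (k : Fin 4) (hk : k = 0 ∨ k = 1) (N : ℕ) (hN : 0 < N),
      ∀ f ∈ ((X V c).P k).weightFunctions,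
        (C V c hc h6 k hk N hN).toProduct.restrictedThetaForm f ∈ ((X V c).D (C V c hc h6 k hk N hN).Γ₀).Hol)
    {L : CMField} {ι₁ : L →+* ℂ} (V : HermSpace3 L ι₁) (c : SeesawCtx L)
    (hc : (thetaModelOf hHD hI h₁ h₃ h emb cover wm (thetaOf _ (thetaClassInputOf _ X)) d12 d34).GoodCtx ι₁ c)
    (h6 : Module.finrank ℚ c.K = 6) :
    Nonempty (ClassSupplyPackN
        (thetaModelOf hHD hI h₁ h₃ h emb cover wm (thetaOf _ (thetaClassInputOf _ X)) d12 d34) V c 0) ∧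
      Nonempty (ClassSupplyPackN
        (thetaModelOf hHD hI h₁ h₃ h emb cover wm (thetaOf _ (thetaClassInputOf _ X)) d12 d34) V c 1) :=
  classPacksOf_productKType hHD hI h₁ h₃ h emb cover wm X d12 d34
    (fun V c hc h6 k hk N hN => (C V c hc h6 k hk N hN).toProduct) hol V c hc h6

end EndState

end Model
end HodgeCM

end
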